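import Summits.BirchSwinnertonDyer.BirchSwinnertonDyer.Theorems.ResidualThetaTransportAtTwoSignedMuVanishingAtTwoPlusSelmerTrivialSeed
import Summits.BirchSwinnertonDyer.BirchSwinnertonDyer.Theorems.ResidualThetaTransportAtTwoSignedMuVanishingAtTwoPlusDescentMuBound
import Literature.NumberTheory.EllipticCurves.SelmerTrivialCorankProofs
import HarnessLib

/-!
# Route `ResidualThetaTransportAtTwo`, crux Kμ⁺ `SignedMuVanishingAtTwoPlus` (stmt-BirchSwinnertonDyer-20689):
# the Kurihara road keyed to K4's REGISTERED stub `stub_plusHondaSystemTwo` and to the 2-DESCENT currency `#Sel₂(A/ℚ) = 1`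

Cell `bsd-wall`, width seat `bsd-wall-rtt-p4-w3` (g2). THEOREMS ONLY (no `def`, no named fact, no `sorry`); helper `--supports` the
crux; nothing about any particular curve is asserted; BSD is not proved by this. Thin sequel of this seat's p588569
`…SignedMuVanishingAtTwoPlusSelmerTrivialSeed` (seed child 21438 / conjunct 1 / the crux BY NAME from a Selmer-trivial UNIT ANCHOR
per residual class under INJ⁺@2 resp. HONDA⁺-data at the anchor).

* §1 `natCard_selmerGroupPInfty_two_eq_one_of_natCard_selmerGroup_two_eq_one` — the anchor certificate in the currency a `2`-descent
  outputs: `#Sel₂(A/ℚ) = 1` (PARI `ellrank(A) = [0,0,0,[]]` as recorded per anchor in UNIT-ANCHOR-CENSUS-v1) gives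
  `#Sel_{2^∞}(A/ℚ) = 1` (tree: `natCard_selmerGroupPInfty_eq_one_of_natCard_selmerGroup_eq_one`, Bhargava–Skinner–Zhang's first
  sentence, Silverman X.4.2).
* §2 `signedMuSeedAtTwoPlus_of_plusHondaSystemTwo_of_anchor` — **the seed child 21438 BY NAME from the REGISTERED signature of K4's
  stub `stub_plusHondaSystemTwo`** (line `eulerchar` v6 of crux `SignedControlAtTwo`, stmt-BirchSwinnertonDyer-20309, VERBATIM as a
  hypothesis: HONDA⁺-data for every habitat curve `¬CM, r_an = 0, GoodSS 2, a₂ = 0` at every cyclotomic `κ` and `v ∋ 2`) **plus one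
  HABITAT ANCHOR per habitat⁺ class** (a congruent `A` which is itself non-CM of analytic rank `0`, good supersingular with `a₂ = 0`,
  `#Sel₂(A/ℚ) = 1`, `2 ∤ ∏ c_ℓ(A)` — e.g. `35a1` for the classes `60725j`, `81305a`); `muAlgebraic_of_plusHondaSystemTwo_of_anchor`
  (conjunct 1 VERBATIM); `signedMuVanishingAtTwoPlus_of_plusHondaSystemTwo_of_anchor_of_analytic` / `…_of_periodUnit_of_flatMuZero`
  (THE CRUX BY NAME with the analytic child resp. PER + FLAT). So the day K4's stub lands, conjunct 1 of Kμ⁺ on every anchored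
  class is a `2`-descent certificate and nothing else.
* §3 `isTorsion_habitat_of_plusHondaSystemTwo_of_rankEq` — **the TORSION clause of conjunct 1 on the WHOLE habitat of K4's stub**
  (`¬CM, r_an = 0, GoodSS 2, a₂ = 0`; no anchor, no `Δ` condition) ⟸ K4's registered stub + the route's support item
  `RankEqAnalyticRankLeOne` BY NAME (this seat's p588943 `isTorsion_two_of_rankEq_of_localInj`); and the descent bound
  `mu_le_habitat_of_plusHondaSystemTwo_of_rankEq`: `μ(X⁺_W) ≤ ord₂ #Sel_{2^∞}(W/ℚ) + ord₂ ∏ c_ℓ(W)` at every such `W`. So, granted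
  K4's stub, conjunct 1 of Kμ⁺ = «`μ = 0`» ALONE.

References: M. Kurihara, Invent. Math. 149 (2002) Thm. 0.1 [Kurihara2002]; M. Kurihara, R. Otsuki, PAMQ 2 (2006) Thm. 0.1, Rem. 0.2 (3)
[KuriharaOtsuki2006]; S. Kobayashi, Invent. Math. 152 (2003) §8 Prop. 8.12, Thm. 9.3 [Kobayashi2003]; M. Bhargava, C. Skinner,
W. Zhang, arXiv:1407.1826 Thm. 5 (proof, first sentence) [BhargavaSkinnerZhang2014]; J. Silverman, AEC X.4.2 [SilvermanAEC2009].
-/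

set_option autoImplicit false
set_option linter.dupNamespace false

noncomputable section

open scoped Classical NumberField MatrixGroups ModularForm

open NumberField IsDedekindDomain CongruenceSubgroup WeierstrassCurve
  Literature.NumberTheory.EllipticCurves Literature.NumberTheory.GaloisRepresentations
  Literature.NumberTheory.EllipticCurves.ModularForms Literature.NumberTheory.EllipticCurves.IwasawaAlgebra
  Literature.NumberTheory.EllipticCurves.Kobayashi2003
  Literature.NumberTheory.EllipticCurves.Rank1Residual Literature.NumberTheory.EllipticCurves.ZpExtension
  Summit.BirchSwinnertonDyer.Rank1Residual.Supersingular
  Summit.BirchSwinnertonDyer.BirchSwinnertonDyer.Theses.ResidualThetaTransportAtTwo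

namespace Summit.BirchSwinnertonDyer.BirchSwinnertonDyer.Theorems.SelmerTrivialSeedAtTwo

/-! ## §1. The anchor certificate in 2-descent currency -/

/-- `#Sel₂(A/ℚ) = 1 ⟹ #Sel_{2^∞}(A/ℚ) = 1` (the first sentence of Bhargava–Skinner–Zhang's proof of their Thm. 5; tree theorem
`natCard_selmerGroupPInfty_eq_one_of_natCard_selmerGroup_eq_one`, displayed at `p = 2` for the anchor certificate).
[cite: BhargavaSkinnerZhang2014, Thm. 5 (proof, first sentence)] [cite: SilvermanAEC2009, Thm. X.4.2] -/
theorem natCard_selmerGroupPInfty_two_eq_one_of_natCard_selmerGroup_two_eq_one (A : WeierstrassCurve ℚ) [A.IsElliptic]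
    (h : Nat.card (A.selmerGroup 2) = 1) : Nat.card (A.selmerGroupPInfty 2) = 1 :=
  Literature.NumberTheory.EllipticCurves.natCard_selmerGroupPInfty_eq_one_of_natCard_selmerGroup_eq_one A (p := 2) h

/-! ## §2. The seed, conjunct 1 and the crux from K4's registered stub + a habitat anchor per class -/

/-- **The seed child 21438 BY NAME from K4's REGISTERED stub `stub_plusHondaSystemTwo` (signature verbatim, as a hypothesis) and a
HABITAT ANCHOR per habitat⁺ class** — a congruent non-CM analytic-rank-`0` good-supersingular `a₂ = 0` curve `A` with `#Sel₂(A/ℚ) = 1` and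
`2 ∤ ∏ c_ℓ(A)`: the stub supplies HONDA⁺-data at `A`, hence INJ⁺@2 at `A` (`plusLocalInj_two_of_hondaData`), hence `Sel⁺(A/ℚ_∞) = 0`.
[cite: Kobayashi2003, §8 Prop. 8.12, Thm. 9.3] [cite: Kurihara2002, Thm. 0.1] [cite: KuriharaOtsuki2006, Rem. 0.2 (3)] -/
theorem signedMuSeedAtTwoPlus_of_plusHondaSystemTwo_of_anchor
    (hH : ∀ (W : WeierstrassCurve ℚ) [W.IsElliptic] [W.IsGloballyMinimal],
      ¬ W.HasCM → W.analyticRank = 0 → GoodSS W 2 → W.frobeniusTrace 2 = 0 →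
      ∀ (κ : ZpExtension ℚ 2), κ.IsCyclotomic →
      ∀ (v : HeightOneSpectrum (𝓞 ℚ)), (2 : 𝓞 ℚ) ∈ v.asIdeal →
      ∃ d : ℕ → localPoints W (v.adicCompletion ℚ),
        (∀ m, d m ∈ localLayerPointsOfEmb κ (closureEmb (K := ℚ) (v.adicCompletion ℚ)) W m) ∧
        (∀ m, localTraceOfEmb κ (closureEmb (K := ℚ) (v.adicCompletion ℚ)) W (m + 1) (m + 2) (d (m + 2)) = -d m) ∧
        (∀ m : ℕ, 1 ≤ m → ∀ P ∈ localLayerPointsOfEmb κ (closureEmb (K := ℚ) (v.adicCompletion ℚ)) W m,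
          ∃ B ∈ AddSubgroup.closure (Set.range fun σ : Field.absoluteGaloisGroup (v.adicCompletion ℚ) ↦ σ • d m),
            ∃ P' ∈ localLayerPointsOfEmb κ (closureEmb (K := ℚ) (v.adicCompletion ℚ)) W (m - 1),
            ∃ R ∈ localLayerPointsOfEmb κ (closureEmb (K := ℚ) (v.adicCompletion ℚ)) W m, P = B + P' + 2 • R) ∧
        (∀ P ∈ localLayerPointsOfEmb κ (closureEmb (K := ℚ) (v.adicCompletion ℚ)) W 0,
          ∃ a : ℤ, ∃ R ∈ localLayerPointsOfEmb κ (closureEmb (K := ℚ) (v.adicCompletion ℚ)) W 0, P = a • d 0 + 2 • R))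
    (hanchor : ∀ (W : WeierstrassCurve ℚ) [W.IsElliptic] [W.IsGloballyMinimal], ¬ W.HasCM → W.analyticRank = 0 →
      GoodSS W 2 → W.frobeniusTrace 2 = 0 → W.Δ < 0 →
      ∃ (A : WeierstrassCurve ℚ) (_ : A.IsElliptic) (_ : A.IsGloballyMinimal), ¬ A.HasCM ∧ A.analyticRank = 0 ∧
        GoodSS A 2 ∧ A.frobeniusTrace 2 = 0 ∧
        (∃ e : WeierstrassCurve.geomTorsion W (2 : ℤ) ≃+ WeierstrassCurve.geomTorsion A (2 : ℤ),
          ∀ (σ : Field.absoluteGaloisGroup ℚ) (P : WeierstrassCurve.geomTorsion W (2 : ℤ)), e (σ • P) = σ • e P) ∧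
        Nat.card (A.selmerGroup 2) = 1 ∧ ¬ 2 ∣ A.tamagawaProduct) :
    SignedMuSeedAtTwoPlus := by
  refine signedMuSeedAtTwoPlus_of_hondaMember fun W _ _ hCM hr hss ha hΔ ↦ ?_
  obtain ⟨A, hAell, hAmin, hACM, hAr, hssA, haA, hiso, hSel2, hTam⟩ := hanchor W hCM hr hss ha hΔ
  exact ⟨A, hAell, hAmin, hssA, haA, hiso, fun κ hκ v hv ↦ hH A hACM hAr hssA haA κ hκ v hv,
    natCard_selmerGroupPInfty_two_eq_one_of_natCard_selmerGroup_two_eq_one A hSel2, hTam⟩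

/-- **Conjunct 1 of Kμ⁺ VERBATIM from K4's registered stub and a habitat anchor per class** (the seed above through the PROVED
propagation 22891, lead g3's `muAlgebraic_iff_signedMuSeedAtTwoPlus`). [cite: GreenbergVatsal2000, Prop. (2.8)] [cite: Kurihara2002, Thm. 0.1] -/
theorem muAlgebraic_of_plusHondaSystemTwo_of_anchor
    (hH : ∀ (W : WeierstrassCurve ℚ) [W.IsElliptic] [W.IsGloballyMinimal],
      ¬ W.HasCM → W.analyticRank = 0 → GoodSS W 2 → W.frobeniusTrace 2 = 0 →
      ∀ (κ : ZpExtension ℚ 2), κ.IsCyclotomic →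
      ∀ (v : HeightOneSpectrum (𝓞 ℚ)), (2 : 𝓞 ℚ) ∈ v.asIdeal →
      ∃ d : ℕ → localPoints W (v.adicCompletion ℚ),
        (∀ m, d m ∈ localLayerPointsOfEmb κ (closureEmb (K := ℚ) (v.adicCompletion ℚ)) W m) ∧
        (∀ m, localTraceOfEmb κ (closureEmb (K := ℚ) (v.adicCompletion ℚ)) W (m + 1) (m + 2) (d (m + 2)) = -d m) ∧
        (∀ m : ℕ, 1 ≤ m → ∀ P ∈ localLayerPointsOfEmb κ (closureEmb (K := ℚ) (v.adicCompletion ℚ)) W m,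
          ∃ B ∈ AddSubgroup.closure (Set.range fun σ : Field.absoluteGaloisGroup (v.adicCompletion ℚ) ↦ σ • d m),
            ∃ P' ∈ localLayerPointsOfEmb κ (closureEmb (K := ℚ) (v.adicCompletion ℚ)) W (m - 1),
            ∃ R ∈ localLayerPointsOfEmb κ (closureEmb (K := ℚ) (v.adicCompletion ℚ)) W m, P = B + P' + 2 • R) ∧
        (∀ P ∈ localLayerPointsOfEmb κ (closureEmb (K := ℚ) (v.adicCompletion ℚ)) W 0,
          ∃ a : ℤ, ∃ R ∈ localLayerPointsOfEmb κ (closureEmb (K := ℚ) (v.adicCompletion ℚ)) W 0, P = a • d 0 + 2 • R))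
    (hanchor : ∀ (W : WeierstrassCurve ℚ) [W.IsElliptic] [W.IsGloballyMinimal], ¬ W.HasCM → W.analyticRank = 0 →
      GoodSS W 2 → W.frobeniusTrace 2 = 0 → W.Δ < 0 →
      ∃ (A : WeierstrassCurve ℚ) (_ : A.IsElliptic) (_ : A.IsGloballyMinimal), ¬ A.HasCM ∧ A.analyticRank = 0 ∧
        GoodSS A 2 ∧ A.frobeniusTrace 2 = 0 ∧
        (∃ e : WeierstrassCurve.geomTorsion W (2 : ℤ) ≃+ WeierstrassCurve.geomTorsion A (2 : ℤ),
          ∀ (σ : Field.absoluteGaloisGroup ℚ) (P : WeierstrassCurve.geomTorsion W (2 : ℤ)), e (σ • P) = σ • e P) ∧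
        Nat.card (A.selmerGroup 2) = 1 ∧ ¬ 2 ∣ A.tamagawaProduct) :
    ∀ (W : WeierstrassCurve ℚ) [W.IsElliptic] [W.IsGloballyMinimal], ¬ W.HasCM → W.analyticRank = 0 →
      GoodSS W 2 → W.frobeniusTrace 2 = 0 → W.Δ < 0 →
      ∀ (κ : ZpExtension ℚ 2) (γ : Field.absoluteGaloisGroup ℚ), κ.IsCyclotomic → κ.IsTopGenerator γ →
      ∀ (D : SignedSelmerDualData W κ γ 1) [Module.Finite (IwasawaAlgebra 2) D.X],
        Module.IsTorsion (IwasawaAlgebra 2) D.X ∧ D.mu = 0 :=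
  SignedMuAtTwo.muAlgebraic_iff_signedMuSeedAtTwoPlus.mpr (signedMuSeedAtTwoPlus_of_plusHondaSystemTwo_of_anchor hH hanchor)

/-- **THE CRUX BY NAME from {K4's registered stub, a habitat anchor per class, the analytic child 21437}.**
[cite: Kurihara2002, Thm. 0.1] [cite: Kobayashi2003, §8 Prop. 8.12, Thm. 9.3] [cite: Pollack2003, Prop. 6.18] -/
theorem signedMuVanishingAtTwoPlus_of_plusHondaSystemTwo_of_anchor_of_analytic (hAn : SignedMuAnalyticAtTwoPlus)
    (hH : ∀ (W : WeierstrassCurve ℚ) [W.IsElliptic] [W.IsGloballyMinimal],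
      ¬ W.HasCM → W.analyticRank = 0 → GoodSS W 2 → W.frobeniusTrace 2 = 0 →
      ∀ (κ : ZpExtension ℚ 2), κ.IsCyclotomic →
      ∀ (v : HeightOneSpectrum (𝓞 ℚ)), (2 : 𝓞 ℚ) ∈ v.asIdeal →
      ∃ d : ℕ → localPoints W (v.adicCompletion ℚ),
        (∀ m, d m ∈ localLayerPointsOfEmb κ (closureEmb (K := ℚ) (v.adicCompletion ℚ)) W m) ∧
        (∀ m, localTraceOfEmb κ (closureEmb (K := ℚ) (v.adicCompletion ℚ)) W (m + 1) (m + 2) (d (m + 2)) = -d m) ∧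
        (∀ m : ℕ, 1 ≤ m → ∀ P ∈ localLayerPointsOfEmb κ (closureEmb (K := ℚ) (v.adicCompletion ℚ)) W m,
          ∃ B ∈ AddSubgroup.closure (Set.range fun σ : Field.absoluteGaloisGroup (v.adicCompletion ℚ) ↦ σ • d m),
            ∃ P' ∈ localLayerPointsOfEmb κ (closureEmb (K := ℚ) (v.adicCompletion ℚ)) W (m - 1),
            ∃ R ∈ localLayerPointsOfEmb κ (closureEmb (K := ℚ) (v.adicCompletion ℚ)) W m, P = B + P' + 2 • R) ∧
        (∀ P ∈ localLayerPointsOfEmb κ (closureEmb (K := ℚ) (v.adicCompletion ℚ)) W 0,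
          ∃ a : ℤ, ∃ R ∈ localLayerPointsOfEmb κ (closureEmb (K := ℚ) (v.adicCompletion ℚ)) W 0, P = a • d 0 + 2 • R))
    (hanchor : ∀ (W : WeierstrassCurve ℚ) [W.IsElliptic] [W.IsGloballyMinimal], ¬ W.HasCM → W.analyticRank = 0 →
      GoodSS W 2 → W.frobeniusTrace 2 = 0 → W.Δ < 0 →
      ∃ (A : WeierstrassCurve ℚ) (_ : A.IsElliptic) (_ : A.IsGloballyMinimal), ¬ A.HasCM ∧ A.analyticRank = 0 ∧
        GoodSS A 2 ∧ A.frobeniusTrace 2 = 0 ∧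
        (∃ e : WeierstrassCurve.geomTorsion W (2 : ℤ) ≃+ WeierstrassCurve.geomTorsion A (2 : ℤ),
          ∀ (σ : Field.absoluteGaloisGroup ℚ) (P : WeierstrassCurve.geomTorsion W (2 : ℤ)), e (σ • P) = σ • e P) ∧
        Nat.card (A.selmerGroup 2) = 1 ∧ ¬ 2 ∣ A.tamagawaProduct) :
    SignedMuVanishingAtTwoPlus :=
  SignedMuAtTwo.signedMuVanishingAtTwoPlus_of_analytic_of_seed hAn (signedMuSeedAtTwoPlus_of_plusHondaSystemTwo_of_anchor hH hanchor)

/-- **THE CRUX BY NAME from {K4's registered stub, a habitat anchor per class, PER, FLAT}** — the `kurihara` composition with its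
local stub IDENTICAL to K4's registered `stub_plusHondaSystemTwo`. [cite: KuriharaOtsuki2006, Thm. 0.1 and Rem. 0.2 (3)]
[cite: Kobayashi2003, §8 Prop. 8.12, Thm. 9.3] [cite: Pollack2003, Prop. 6.18] [cite: AbbesUllmo1996, Thm. A] -/
theorem signedMuVanishingAtTwoPlus_of_plusHondaSystemTwo_of_anchor_of_periodUnit_of_flatMuZero
    (hH : ∀ (W : WeierstrassCurve ℚ) [W.IsElliptic] [W.IsGloballyMinimal],
      ¬ W.HasCM → W.analyticRank = 0 → GoodSS W 2 → W.frobeniusTrace 2 = 0 →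
      ∀ (κ : ZpExtension ℚ 2), κ.IsCyclotomic →
      ∀ (v : HeightOneSpectrum (𝓞 ℚ)), (2 : 𝓞 ℚ) ∈ v.asIdeal →
      ∃ d : ℕ → localPoints W (v.adicCompletion ℚ),
        (∀ m, d m ∈ localLayerPointsOfEmb κ (closureEmb (K := ℚ) (v.adicCompletion ℚ)) W m) ∧
        (∀ m, localTraceOfEmb κ (closureEmb (K := ℚ) (v.adicCompletion ℚ)) W (m + 1) (m + 2) (d (m + 2)) = -d m) ∧
        (∀ m : ℕ, 1 ≤ m → ∀ P ∈ localLayerPointsOfEmb κ (closureEmb (K := ℚ) (v.adicCompletion ℚ)) W m,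
          ∃ B ∈ AddSubgroup.closure (Set.range fun σ : Field.absoluteGaloisGroup (v.adicCompletion ℚ) ↦ σ • d m),
            ∃ P' ∈ localLayerPointsOfEmb κ (closureEmb (K := ℚ) (v.adicCompletion ℚ)) W (m - 1),
            ∃ R ∈ localLayerPointsOfEmb κ (closureEmb (K := ℚ) (v.adicCompletion ℚ)) W m, P = B + P' + 2 • R) ∧
        (∀ P ∈ localLayerPointsOfEmb κ (closureEmb (K := ℚ) (v.adicCompletion ℚ)) W 0,
          ∃ a : ℤ, ∃ R ∈ localLayerPointsOfEmb κ (closureEmb (K := ℚ) (v.adicCompletion ℚ)) W 0, P = a • d 0 + 2 • R))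
    (hanchor : ∀ (W : WeierstrassCurve ℚ) [W.IsElliptic] [W.IsGloballyMinimal], ¬ W.HasCM → W.analyticRank = 0 →
      GoodSS W 2 → W.frobeniusTrace 2 = 0 → W.Δ < 0 →
      ∃ (A : WeierstrassCurve ℚ) (_ : A.IsElliptic) (_ : A.IsGloballyMinimal), ¬ A.HasCM ∧ A.analyticRank = 0 ∧
        GoodSS A 2 ∧ A.frobeniusTrace 2 = 0 ∧
        (∃ e : WeierstrassCurve.geomTorsion W (2 : ℤ) ≃+ WeierstrassCurve.geomTorsion A (2 : ℤ),
          ∀ (σ : Field.absoluteGaloisGroup ℚ) (P : WeierstrassCurve.geomTorsion W (2 : ℤ)), e (σ • P) = σ • e P) ∧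
        Nat.card (A.selmerGroup 2) = 1 ∧ ¬ 2 ∣ A.tamagawaProduct)
    (hper : ∀ (W : WeierstrassCurve ℚ) [W.IsElliptic] [W.IsGloballyMinimal], GoodSS W 2 →
      ∀ [NeZero (W.conductorNorm ℤ)] (f : CuspForm (Gamma0 (W.conductorNorm ℤ)) 2), IsNewformOf W f →
      ∃ u : ℚ, ‖(u : ℚ_[2])‖ = 1 ∧ W.realPeriodRat = u * plusPeriod f)
    (hflat : ∀ (W : WeierstrassCurve ℚ) [W.IsElliptic] [W.IsGloballyMinimal], ¬ W.HasCM →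
      W.analyticRank = 0 → GoodSS W 2 → W.frobeniusTrace 2 = 0 → W.Δ < 0 →
      ∀ [NeZero (W.conductorNorm ℤ)] (f : CuspForm (Gamma0 (W.conductorNorm ℤ)) 2), IsNewformOf W f →
      ∀ (Lplus Lminus : IwasawaAlgebra 2), IsPollackPair f 2 Lplus Lminus →
      ¬ PowerSeries.C (2 : ℤ_[2]) ∣ Lminus) :
    SignedMuVanishingAtTwoPlus :=
  SignedMuAtTwo.signedMuVanishingAtTwoPlus_of_seed_of_periodUnit_of_flatMuZero
    (signedMuSeedAtTwoPlus_of_plusHondaSystemTwo_of_anchor hH hanchor) hper hflat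

/-! ## §3. The torsion clause of conjunct 1 on the whole habitat of K4's stub, and the descent bound there -/

/-- **The TORSION clause of conjunct 1 of Kμ⁺ on the habitat of K4's stub** (`¬CM`, `r_an = 0`, good supersingular at `2`, `a₂ = 0`; no
`Δ` condition, no anchor): granted the registered signature of `stub_plusHondaSystemTwo` and Gross–Zagier–Kolyvagin BY NAME
(`RankEqAnalyticRankLeOne`), every `+` signed Selmer dual datum at every cyclotomic pair is finitely generated and `Λ`-TORSION
(INJ⁺@2 from the Honda data, `Sel_{2^∞}(W/ℚ)` finite at analytic rank `0`, then p588943 `isTorsion_two_of_rankEq_of_localInj`).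
[cite: GreenbergLNM1716, §1 p. 61 (proof of Thm. 1.4)] [cite: Kobayashi2003, §8 Prop. 8.12, Thm. 9.3] [cite: BDKim2013, proof of Cor. 3.15] -/
theorem isTorsion_habitat_of_plusHondaSystemTwo_of_rankEq
    (hH : ∀ (W : WeierstrassCurve ℚ) [W.IsElliptic] [W.IsGloballyMinimal],
      ¬ W.HasCM → W.analyticRank = 0 → GoodSS W 2 → W.frobeniusTrace 2 = 0 →
      ∀ (κ : ZpExtension ℚ 2), κ.IsCyclotomic →
      ∀ (v : HeightOneSpectrum (𝓞 ℚ)), (2 : 𝓞 ℚ) ∈ v.asIdeal →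
      ∃ d : ℕ → localPoints W (v.adicCompletion ℚ),
        (∀ m, d m ∈ localLayerPointsOfEmb κ (closureEmb (K := ℚ) (v.adicCompletion ℚ)) W m) ∧
        (∀ m, localTraceOfEmb κ (closureEmb (K := ℚ) (v.adicCompletion ℚ)) W (m + 1) (m + 2) (d (m + 2)) = -d m) ∧
        (∀ m : ℕ, 1 ≤ m → ∀ P ∈ localLayerPointsOfEmb κ (closureEmb (K := ℚ) (v.adicCompletion ℚ)) W m,
          ∃ B ∈ AddSubgroup.closure (Set.range fun σ : Field.absoluteGaloisGroup (v.adicCompletion ℚ) ↦ σ • d m),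
            ∃ P' ∈ localLayerPointsOfEmb κ (closureEmb (K := ℚ) (v.adicCompletion ℚ)) W (m - 1),
            ∃ R ∈ localLayerPointsOfEmb κ (closureEmb (K := ℚ) (v.adicCompletion ℚ)) W m, P = B + P' + 2 • R) ∧
        (∀ P ∈ localLayerPointsOfEmb κ (closureEmb (K := ℚ) (v.adicCompletion ℚ)) W 0,
          ∃ a : ℤ, ∃ R ∈ localLayerPointsOfEmb κ (closureEmb (K := ℚ) (v.adicCompletion ℚ)) W 0, P = a • d 0 + 2 • R))
    (hGZK : RankEqAnalyticRankLeOne) :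
    ∀ (W : WeierstrassCurve ℚ) [W.IsElliptic] [W.IsGloballyMinimal], ¬ W.HasCM → W.analyticRank = 0 →
      GoodSS W 2 → W.frobeniusTrace 2 = 0 →
      ∀ (κ : ZpExtension ℚ 2) (γ : Field.absoluteGaloisGroup ℚ), κ.IsCyclotomic → κ.IsTopGenerator γ →
      ∀ (D : SignedSelmerDualData W κ γ 1),
        Module.Finite (IwasawaAlgebra 2) D.X ∧ Module.IsTorsion (IwasawaAlgebra 2) D.X :=
  fun W _ _ hCM hr hss ha ↦ isTorsion_two_of_rankEq_of_localInj hGZK W hr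
    fun κ hκ v hv ↦ plusLocalInj_two_of_hondaData W hss hκ v hv (hH W hCM hr hss ha κ hκ v hv)

/-- **The descent bound on the habitat of K4's stub**: granted `stub_plusHondaSystemTwo` and GZK by name, every `+` signed Selmer dual
datum of every such `W` has `μ(X⁺) ≤ ord₂ #Sel_{2^∞}(W/ℚ) + ord₂ ∏ c_ℓ(W)` (p588943 `mu_le_two_of_rankEq_of_localInj`).
[cite: GreenbergLNM1716, §4 Lemma 4.2 (p. 102)] [cite: Kurihara2002, Thm. 0.1] -/
theorem mu_le_habitat_of_plusHondaSystemTwo_of_rankEq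
    (hH : ∀ (W : WeierstrassCurve ℚ) [W.IsElliptic] [W.IsGloballyMinimal],
      ¬ W.HasCM → W.analyticRank = 0 → GoodSS W 2 → W.frobeniusTrace 2 = 0 →
      ∀ (κ : ZpExtension ℚ 2), κ.IsCyclotomic →
      ∀ (v : HeightOneSpectrum (𝓞 ℚ)), (2 : 𝓞 ℚ) ∈ v.asIdeal →
      ∃ d : ℕ → localPoints W (v.adicCompletion ℚ),
        (∀ m, d m ∈ localLayerPointsOfEmb κ (closureEmb (K := ℚ) (v.adicCompletion ℚ)) W m) ∧
        (∀ m, localTraceOfEmb κ (closureEmb (K := ℚ) (v.adicCompletion ℚ)) W (m + 1) (m + 2) (d (m + 2)) = -d m) ∧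
        (∀ m : ℕ, 1 ≤ m → ∀ P ∈ localLayerPointsOfEmb κ (closureEmb (K := ℚ) (v.adicCompletion ℚ)) W m,
          ∃ B ∈ AddSubgroup.closure (Set.range fun σ : Field.absoluteGaloisGroup (v.adicCompletion ℚ) ↦ σ • d m),
            ∃ P' ∈ localLayerPointsOfEmb κ (closureEmb (K := ℚ) (v.adicCompletion ℚ)) W (m - 1),
            ∃ R ∈ localLayerPointsOfEmb κ (closureEmb (K := ℚ) (v.adicCompletion ℚ)) W m, P = B + P' + 2 • R) ∧
        (∀ P ∈ localLayerPointsOfEmb κ (closureEmb (K := ℚ) (v.adicCompletion ℚ)) W 0,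
          ∃ a : ℤ, ∃ R ∈ localLayerPointsOfEmb κ (closureEmb (K := ℚ) (v.adicCompletion ℚ)) W 0, P = a • d 0 + 2 • R))
    (hGZK : RankEqAnalyticRankLeOne) :
    ∀ (W : WeierstrassCurve ℚ) [W.IsElliptic] [W.IsGloballyMinimal], ¬ W.HasCM → W.analyticRank = 0 →
      GoodSS W 2 → W.frobeniusTrace 2 = 0 →
      ∀ (κ : ZpExtension ℚ 2) (γ : Field.absoluteGaloisGroup ℚ), κ.IsCyclotomic → κ.IsTopGenerator γ →
      ∀ (D : SignedSelmerDualData W κ γ 1),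
        D.mu ≤ padicValNat 2 (Nat.card (W.selmerGroupPInfty 2)) + padicValNat 2 W.tamagawaProduct :=
  fun W _ _ hCM hr hss ha κ _γ hκ hγ D ↦ mu_le_two_of_rankEq_of_localInj hGZK W hr hκ hγ
    (fun v hv ↦ plusLocalInj_two_of_hondaData W hss hκ v hv (hH W hCM hr hss ha κ hκ v hv)) D

end Summit.BirchSwinnertonDyer.BirchSwinnertonDyer.Theorems.SelmerTrivialSeedAtTwo

end
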